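import Literature.Computability.Cryptography.LWESelfTestSamplerProg
import Literature.Computability.Cryptography.LWEGuessTestLayout
import Literature.Computability.Cryptography.LWEDimensionExtension
import Literature.Computability.Cryptography.LWESecretLaws
import HarnessLib

/-!
# The secret shift and the dimension extension of BLPRS's Thm. 4.1 as typed polynomial-time programs, and their laws on uniform coins

Topic `Computability/Cryptography` (LWE), grouping namespace `BLPRS2013.KProg`; sequel of `LWESelfTestSamplerProg.lean` (`wordsOf`/`tFlat`: residues of coin words, `dotMod`)
and program-level companion of `LWESecretLaws.secretShift` (`(a, b) ↦ (a, b + ⟨a, t⟩)` with ONE fresh `t ← U`) and `LWEDimensionExtension.dimExtend 0`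
(`(a, b) ↦ ((d | a), b)` with a fresh `d ← U` per sample) — the two outer transformations of candidate `E₂ = dimExtendThen 0 ∘ shiftThen ∘ hybridB₂`
(`BLPRSSection4AssemblyExplicit.candE₂`). The machine draws `t` and the `d`'s as residues of coin words, so its laws are the residue versions `machShift`,
`machDimExt` (close to the exact ones: `tvDist_machShift_le`, `tvDist_machDimExt_le`). Everything PROVED; definitions with bodies; no named fact:

* `shiftFlat Q L n items coins`, `shiftFlat_codeFP`, `machShift`, `tvDist_machShift_le` (`≤ n·Q/2ᴸ`), **`uniformVector_map_shiftFlat`**;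
* `dimExtFlat Q L items coins`, `dimExtFlat_codeFP`, `machDimExt`, `dimExtend_zero_eq`, `tvDist_machDimExt_le` (`≤ m·Q/2ᴸ`), **`uniformVector_map_dimExtFlat`**.

## References

* Z. Brakerski, A. Langlois, C. Peikert, O. Regev, D. Stehlé, *Classical hardness of learning with errors*, STOC 2013; arXiv:1306.0281, Thm. 4.1 (proof: the
  dimension reduction `k+1 → k` and the random self-reduction), Def. 2.11 (remark) and §5. [BrakerskiEtAl2013]
* O. Regev, *On lattices, learning with errors …*, J. ACM 56 (2009), Lemma 4.1 (proof: the shift `t` from coins). [RegevLWE2009]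
* S. Arora, B. Barak, *Computational Complexity: A Modern Approach*, CUP 2009, §1.3, Def. 7.1. [AroraBarak2009]
-/

noncomputable section

open scoped ENNReal
open PMF Literature.Probability.Distributions Literature.Algebra.EuclideanLattices

namespace Literature.Computability.Cryptography

namespace BLPRS2013

namespace KProg

open Literature.Computability.Complexity Literature.Computability.Complexity.CodeFP Literature.Computability.QuantumComplexity
  GaussRejMachine LWE LWE.MP12 LWE.MP12.Prog Matrix
open Literature.Algebra.EuclideanLattices (encodeRat encodeRat_injective)

/-! ### The secret shift -/

/-- **Shift every item by ONE fresh `t`** read off the first `nL` coins: `(a, b) ↦ (a, (b + ⟨a, t⟩) mod Q)`. [cite: BrakerskiEtAl2013, Def. 2.11 (remark); RegevLWE2009, Lemma 4.1 (proof)] -/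
def shiftFlat (Q L n : ℕ) (items : List LItem) (coins : List Bool) : List LItem :=
  let t := wordsOf Q L n coins
  items.map fun it => (it.1, dotMod Q it.1 t it.2)

/-- The shift is typed polynomial time in `((Q, (L, n)), (items, coins))`. [cite: AroraBarak2009, §1.3] -/
theorem shiftFlat_codeFP : CodeFP (pairE (pairE natE (pairE unE unE)) (pairE (rawE itemRawE) strE)) (rawE itemRawE)
    (fun p => shiftFlat p.1.1 p.1.2.1 p.1.2.2 p.2.1 p.2.2) := by
  have hpar : CodeFP (pairE (pairE natE (pairE unE unE)) (pairE (rawE itemRawE) strE)) (pairE natE (pairE unE unE)) (fun p => p.1) := fst _ _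
  have hits : CodeFP (pairE (pairE natE (pairE unE unE)) (pairE (rawE itemRawE) strE)) (rawE itemRawE) (fun p => p.2.1) := (snd _ _).fst'
  have hc : CodeFP (pairE (pairE natE (pairE unE unE)) (pairE (rawE itemRawE) strE)) strE (fun p => p.2.2) := (snd _ _).snd'
  have ht : CodeFP (pairE (pairE natE (pairE unE unE)) (pairE (rawE itemRawE) strE)) (rawE natE) (fun p => wordsOf p.1.1 p.1.2.1 p.1.2.2 p.2.2) :=
    (wordsOf_codeFP.comp (hpar.pair hc) :)
  -- one item with context `(Q, t)`
  have hstep : CodeFP (pairE (pairE natE (rawE natE)) itemRawE) itemRawE (fun s => (s.2.1, dotMod s.1.1 s.2.1 s.1.2 s.2.2)) :=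
    ((snd _ _).fst'.pair (dotMod_codeFP.comp ((fst _ _).fst'.pair ((snd _ _).fst'.pair ((fst _ _).snd'.pair (snd _ _).snd')))) :)
  exact (((map hstep).comp ((hpar.fst'.pair ht).pair hits)).congr fun p => rfl)

section ShiftLaw

variable {Q : ℕ} [NeZero Q] {n : ℕ}

/-- **The machine's shift law**: `t` from residues. [cite: RegevLWE2009, Lemma 4.1 (proof)] -/
def machShift (L m : ℕ) (S : Fin m → (Fin n → ZMod Q) × ZMod Q) : PMF (Fin m → (Fin n → ZMod Q) × ZMod Q) :=
  (iidPMF (modLaw (2 ^ L) Q) n).map fun t => shiftSample t ∘ S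

/-- **The machine's shift is `n·Q/2ᴸ`-close to `secretShift`.** [cite: RegevLWE2009, Lemma 4.1 (proof); Goldreich2001, §3.2.1] -/
theorem tvDist_machShift_le (L m : ℕ) (S : Fin m → (Fin n → ZMod Q) × ZMod Q) :
    (machShift L m S).tvDist (secretShift m S) ≤ n * ((Q : ℝ) / 2 ^ L) := by
  unfold machShift secretShift
  refine (PMF.tvDist_map_le_holds _ _ _).trans ?_
  have := tvDist_iidPMF_modLaw_le (2 ^ L) Q n
  push_cast at this
  exact this

/-- **On uniform coins the shift program samples `machShift`** (read through `toItem`), for coin strings of length `C ≥ nL`.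
[cite: BrakerskiEtAl2013, Def. 2.11 (remark); RegevLWE2009, Lemma 4.1 (proof); AroraBarak2009, Def. 7.1] -/
theorem uniformVector_map_shiftFlat (L : ℕ) {m : ℕ} (S : Fin m → (Fin n → ZMod Q) × ZMod Q) {C : ℕ} (hC : n * L ≤ C) :
    (uniformOfFintype (List.Vector Bool C)).map (fun v => shiftFlat Q L n (List.ofFn fun i => toItem (S i)) v.toList) =
      (machShift L m S).map fun S' => List.ofFn fun i => toItem (S' i) := by
  have hLn : L * n ≤ C := (le_of_eq (Nat.mul_comm L n)).trans hC
  have hfac : (fun v : List.Vector Bool C => shiftFlat Q L n (List.ofFn fun i => toItem (S i)) v.toList) =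
      (fun t : Fin n → ZMod Q => List.ofFn fun i => toItem (d := n) (Q := Q) (shiftSample t (S i))) ∘ shiftOfCoins Q L n hLn := by
    funext v
    simp only [Function.comp_apply, shiftFlat, wordsOf_eq_tFlat, tFlat_eq_encT hLn, List.map_ofFn]
    congr 1
    funext i
    simp only [Function.comp_apply, toItem, shiftSample, Prod.mk.injEq, true_and]
    rw [show (List.ofFn fun j => ((S i).1 j).val) = encT (S i).1 from rfl, dotMod_encT, add_comm]
  rw [hfac, ← PMF.map_comp, uniformVector_map_shift, machShift, PMF.map_comp]
  rfl

end ShiftLaw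

/-! ### The dimension extension -/

/-- **Prepend a fresh residue to every `a`**: item `i` gets `d_i = (i-th word of L coins) mod Q`. [cite: BrakerskiEtAl2013, Thm. 4.1 (proof)] -/
def dimExtFlat (Q L : ℕ) (items : List LItem) (coins : List Bool) : List LItem :=
  List.zipWith (fun it d => (d :: it.1, it.2)) items (wordsOf Q L items.length coins)

/-- The dimension extension is typed polynomial time in `((Q, L), (items, coins))`. [cite: AroraBarak2009, §1.3] -/
theorem dimExtFlat_codeFP : CodeFP (pairE (pairE natE unE) (pairE (rawE itemRawE) strE)) (rawE itemRawE) (fun p => dimExtFlat p.1.1 p.1.2 p.2.1 p.2.2) := by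
  have hQ : CodeFP (pairE (pairE natE unE) (pairE (rawE itemRawE) strE)) natE (fun p => p.1.1) := (fst _ _).fst'
  have hL : CodeFP (pairE (pairE natE unE) (pairE (rawE itemRawE) strE)) unE (fun p => p.1.2) := (fst _ _).snd'
  have hits : CodeFP (pairE (pairE natE unE) (pairE (rawE itemRawE) strE)) (rawE itemRawE) (fun p => p.2.1) := (snd _ _).fst'
  have hc : CodeFP (pairE (pairE natE unE) (pairE (rawE itemRawE) strE)) strE (fun p => p.2.2) := (snd _ _).snd'
  have hm : CodeFP (pairE (pairE natE unE) (pairE (rawE itemRawE) strE)) unE (fun p => p.2.1.length) := ((ulength _).comp hits :)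
  have hds : CodeFP (pairE (pairE natE unE) (pairE (rawE itemRawE) strE)) (rawE natE) (fun p => wordsOf p.1.1 p.1.2 p.2.1.length p.2.2) :=
    (wordsOf_codeFP.comp ((hQ.pair (hL.pair hm)).pair hc) :)
  have hstep : CodeFP (pairE (pairE (pairE natE unE) (pairE (rawE itemRawE) strE)) (pairE itemRawE natE)) itemRawE (fun s => (s.2.2 :: s.2.1.1, s.2.1.2)) :=
    (((rawCons natE).comp ((snd _ _).snd'.pair (snd _ _).fst'.fst')).pair (snd _ _).fst'.snd' :)
  exact (((zipWith hstep).comp ((CodeFP.id _).pair (hits.pair hds))).congr fun p => rfl)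

section DimLaw

variable {Q : ℕ} [NeZero Q] {k : ℕ}

/-- **The machine's dimension extension law**: the fresh first coordinates from residues. [cite: BrakerskiEtAl2013, Thm. 4.1 (proof)] -/
def machDimExt (L m : ℕ) (S : Fin m → (Fin k → ZMod Q) × ZMod Q) : PMF (Fin m → (Fin (k + 1) → ZMod Q) × ZMod Q) :=
  (iidPMF (modLaw (2 ^ L) Q) m).map fun ds i => (vecCons (ds i) (S i).1, (S i).2)

/-- `dimExtend 0` prepends the fresh coordinate and leaves `b` alone. [folklore] -/
theorem dimExtend_zero_eq (m : ℕ) (S : Fin m → (Fin k → ZMod Q) × ZMod Q) :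
    dimExtend (0 : ZMod Q) m S = (iidPMF (PMF.uniformOfFintype (ZMod Q)) m).map fun ds i => (vecCons (ds i) (S i).1, (S i).2) := by
  rw [show dimExtend (0 : ZMod Q) m S = felCoinsMap (1 : Matrix (Fin (k + 1)) (Fin (k + 1)) (ZMod Q)) 0 m S from rfl, felCoinsMap]
  congr 1
  funext ds
  funext i
  simp [felSampleMap]

/-- **The machine's dimension extension is `m·Q/2ᴸ`-close to `dimExtend 0`.** [cite: Goldreich2001, §3.2.1, §3.2.3] -/
theorem tvDist_machDimExt_le (L m : ℕ) (S : Fin m → (Fin k → ZMod Q) × ZMod Q) :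
    (machDimExt L m S).tvDist (dimExtend (0 : ZMod Q) m S) ≤ m * ((Q : ℝ) / 2 ^ L) := by
  rw [dimExtend_zero_eq]
  unfold machDimExt
  refine (PMF.tvDist_map_le_holds _ _ _).trans ?_
  have h1 := tvDist_modLaw_uniform_le (2 ^ L) Q
  push_cast at h1
  exact (tvDist_iidPMF_le _ _ m).trans (mul_le_mul_of_nonneg_left h1 (Nat.cast_nonneg m))

omit [NeZero Q] in
/-- `toItem` of a sample with a prepended coordinate. [folklore] -/
theorem toItem_vecCons (d : ZMod Q) (x : (Fin k → ZMod Q) × ZMod Q) :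
    toItem ((vecCons d x.1, x.2) : (Fin (k + 1) → ZMod Q) × ZMod Q) = (d.val :: (toItem x).1, (toItem x).2) := by
  unfold toItem
  simp only [Prod.mk.injEq, and_true]
  rw [List.ofFn_succ]
  simp

/-- **On uniform coins the dimension-extension program samples `machDimExt`** (read through `toItem`), for coin strings of length `C ≥ mL`.
[cite: BrakerskiEtAl2013, Thm. 4.1 (proof); AroraBarak2009, Def. 7.1] -/
theorem uniformVector_map_dimExtFlat (L : ℕ) {m : ℕ} (S : Fin m → (Fin k → ZMod Q) × ZMod Q) {C : ℕ} (hC : m * L ≤ C) :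
    (uniformOfFintype (List.Vector Bool C)).map (fun v => dimExtFlat Q L (List.ofFn fun i => toItem (S i)) v.toList) =
      (machDimExt L m S).map fun S' => List.ofFn fun i => toItem (S' i) := by
  have hLm : L * m ≤ C := (le_of_eq (Nat.mul_comm L m)).trans hC
  have hfac : (fun v : List.Vector Bool C => dimExtFlat Q L (List.ofFn fun i => toItem (S i)) v.toList) =
      (fun ds : Fin m → ZMod Q => List.ofFn fun i => toItem ((vecCons (ds i) (S i).1, (S i).2) : (Fin (k + 1) → ZMod Q) × ZMod Q)) ∘
        shiftOfCoins Q L m hLm := by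
    funext v
    simp only [Function.comp_apply, dimExtFlat, List.length_ofFn, wordsOf_eq_tFlat, tFlat_eq_encT hLm, encT, zipWith_ofFn_ofFn]
    congr 1
    funext i
    rw [toItem_vecCons]
  rw [hfac, ← PMF.map_comp, uniformVector_map_shift, machDimExt, PMF.map_comp]
  rfl

end DimLaw

end KProg

end BLPRS2013

end Literature.Computability.Cryptography

end
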